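import Summits.BirchSwinnertonDyer.BirchSwinnertonDyer.Theorems.ByReductionTypeAtTwoOrdKatoHalfAtTwoIsoResidueImage
import Summits.BirchSwinnertonDyer.BirchSwinnertonDyer.Theorems.ByReductionTypeAtTwoOrdKatoHalfAtTwoIsoResidueConj
import Summits.BirchSwinnertonDyer.BirchSwinnertonDyer.Theorems.ByReductionTypeAtTwoOrdKatoHalfAtTwoIsoSteinbergSahTwist
import Summits.BirchSwinnertonDyer.BirchSwinnertonDyer.Theorems.AlignedTransportAtTwoMainConjectureOfRankZeroBSDAtTwoFineRoadTowerImage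
import Literature.NumberTheory.GaloisRepresentations.CyclotomicLevels
import HarnessLib

/-!
# Route ByReductionTypeAtTwo, crux `OrdKatoHalfAtTwoIso` (stmt-BirchSwinnertonDyer-19573), line
# `steinberg-fibre-at-two` v4: the GALOIS SIDE at `p = 2` on the residue (helpers H6, H6′, H6″, H7, H9 of
# the `stub_port` plan)

HONEST FRAMING (cell bsd-2adic): BSD is not proved by any of this; the crux `OrdKatoHalfAtTwoIso` is NOT
proved here; `stub_port` is not proved here; nothing is booked. This file is a KERNEL HELPER for the line
`Cruxes/OrdKatoHalfAtTwoIso/Lines/steinberg_fibre_at_two.lean` (the Galois side of the S₃-port of the odd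
Euler-system core, `--supports stmt-BirchSwinnertonDyer-19573 --as helper`); theorems only — no definition,
no named fact, no `sorry`. Credit: the statements are the typed helper lemmas H6/H6′/H6″/H7/H9 of
sidea-stub_port-1 STUB-IDEAS-1 @82c64e14eec0e2be (`StubPortHelpersAtTwo.lean` §B).

Setting. `W/ℚ` elliptic, `E[2] ∖ 0 = {T₀, T₁, T₂}` with `σ T_i = T_{permGal σ i}` (tree
`DokchitserDokchitser2012.permGal`, Silverman *AEC* III.§7), `ρ̄₂ = galoisRepTorsion W 2`;
`κ : ZpExtension ℚ 2` a `ℤ₂`-extension of `ℚ` (Washington §13.1), `κ.kerSubgroup = Gal(ℚ̄/ℚ_∞)`,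
`κ.layerSubgroup n = Gal(ℚ̄/ℚ_n)`, `κ.IsTopGenerator γ ⟺ κ γ = 1 ∈ ℤ₂`; `rootsOfUnityFixer ℚ 4 = Gal(ℚ̄/ℚ(i))`.

What replaces what. In the odd core (`…X9TopGenerator`, `…X9CentralScalar` §4, `GaloisImage.AbelianExtensionTorsion`)
the three Galois-side inputs are proved from `p ∤ #ρ̄(Γ)` resp. `p` odd; both are FALSE at `p = 2` on the residue
(`ρ̄₂` onto `S₃`, of order `6`). Here they are re-proved at `p = 2` from the residue data
«`E[2]` irreducible, `Δ < 0`» resp. «`ρ̄₂` onto»: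

* (H6) `ker_galoisRepTorsion_sup_kerSubgroup_eq_top_two` — `Γ_ℚ = ker ρ̄₂ · Gal(ℚ̄/ℚ_∞)`: `Gal(ℚ̄/ℚ_∞)` contains a
  `3`-cycle (`TowerImage.exists_fpf_mem_kerSubgroup_of_irreducible`) and the transposition complex conjugation
  (`SteinbergFibreAtTwo.sign_permGal_eq_neg_one_of_isComplexConjugation_of_Δ_neg`; complex conjugation is an
  involution, so it lies in the kernel of EVERY `ℤ₂`-extension), hence maps onto `S₃`; proved for ANY `κ`
  (`…_of_irreducible_of_Δ_neg`), the verbatim cyclotomic binder list is a one-line corollary.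
* (H6′) `exists_isTopGenerator_forall_smul_eq_two` — a topological generator `γ₀` of `κ` with `ρ̄₂(γ₀) = 1`
  (write a given generator `γ = ν σ`, `ν ∈ ker ρ̄₂`, `σ ∈ ker κ`, and take `γ₀ = ν`).
* (H6″) `sq_mem_rootsOfUnityFixer_four` — squares fix `μ₄` (`(ℤ/4)ˣ` has exponent `2`).
* (H7) `exists_mem_ker_inf_layerSubgroup_not_mem_two` — the depth element `σ = γ₀^{2ⁿ} = (γ₀^{2^{n-1}})²`,
  `n ≥ 1`: in `ker ρ̄₂ ⊓ Gal(ℚ̄/ℚ_n)`, fixing `μ₄`, not in `Gal(ℚ̄/ℚ_{n+1})`.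
* (H9) `geomTorsion_eq_zero_of_fixed_of_commutator_le_two` — `ρ̄₂` onto ⇒ `ρ̄₂([Γ,Γ]) ∋` a `3`-cycle (the
  commutator of two non-commuting transpositions), which fixes no non-zero point of `E[2]`: `E(ℚ^{ab})[2] = 0`.

References: J.-P. Serre, Invent. Math. 15 (1972), §5.3 [Serre1972]; L. C. Washington, *Introduction to
Cyclotomic Fields*, GTM 83 (1997), §13.1–§13.2 [Washington1997]; J. H. Silverman, *AEC*, GTM 106 (2009), III.§7
[SilvermanAEC2009]; the tree's `…ResidueImage.lean`, `…ResidueConj.lean`, `…SteinbergSahTwist.lean`,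
`…FineRoadTowerImage.lean`, `CyclotomicLevels.lean`.
-/

set_option autoImplicit false
set_option linter.dupNamespace false

noncomputable section

open Field WeierstrassCurve
open Literature.NumberTheory.EllipticCurves Literature.NumberTheory.GaloisRepresentations
open Literature.NumberTheory.EllipticCurves.DokchitserDokchitser2012
open Summit.BirchSwinnertonDyer.BirchSwinnertonDyer.Theorems
open scoped commutatorElement

-- D-0017: single-problem summit, so `Summit.BirchSwinnertonDyer.BirchSwinnertonDyer.…` repeats a namespace BY DESIGN.
namespace Summit.BirchSwinnertonDyer.BirchSwinnertonDyer.Rank1Residual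

/-! ### §0. Three kernel-decidable facts -/

/-- `S₃` as six words in a fixed-point-free permutation `z` (a `3`-cycle) and an odd permutation `t`
(a transposition): `S₃ = {1, z, z², t, tz, tz²}`. [folklore] -/
private theorem perm_fin_three_eq_word_of_fpf_of_sign_eq_neg_one :
    ∀ z t : Equiv.Perm (Fin 3), (∀ i, z i ≠ i) → Equiv.Perm.sign t = -1 → ∀ k : Equiv.Perm (Fin 3),
      k = 1 ∨ k = z ∨ k = z * z ∨ k = t ∨ k = t * z ∨ k = t * z * z := by
  decide

/-- The commutator of the transpositions `(0 1)` and `(1 2)` is a `3`-cycle: it moves every letter.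
[folklore] -/
private theorem commutator_swap_apply_ne :
    ∀ i : Fin 3, (⁅Equiv.swap (0 : Fin 3) 1, Equiv.swap (1 : Fin 3) 2⁆ : Equiv.Perm (Fin 3)) i ≠ i := by
  decide

/-- `(ℤ/4)ˣ = {±1}` has exponent `2`. [folklore] -/
private theorem units_zmod_four_sq_eq_one : ∀ u : (ZMod 4)ˣ, u ^ 2 = 1 := by
  decide

/-! ### §1. Group theory: splitting a topological generator along `ker ρ ⊔ ker κ = ⊤` -/

section AnyField

universe u

variable {F : Type u} [Field F] {p : ℕ} [Fact p.Prime] (κ : ZpExtension F p)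

/-- If `H · ker κ = Γ_F` then every `g ∈ Γ_F` is `ν σ` with `ν ∈ H`, `σ ∈ ker κ` (`ker κ` is normal, so
`H ⊔ ker κ = H · ker κ` as sets, Mathlib `Subgroup.mul_normal`). [cite: Washington1997, §13.1] -/
theorem exists_mem_mul_mem_kerSubgroup_eq_of_sup_eq_top {H : Subgroup (absoluteGaloisGroup F)}
    (hsup : H ⊔ κ.kerSubgroup = ⊤) (g : absoluteGaloisGroup F) :
    ∃ ν ∈ H, ∃ σ ∈ κ.kerSubgroup, ν * σ = g := by
  haveI : κ.kerSubgroup.Normal := MonoidHom.normal_ker _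
  have hg : g ∈ ((H ⊔ κ.kerSubgroup : Subgroup (absoluteGaloisGroup F)) : Set (absoluteGaloisGroup F)) := by
    rw [hsup, Subgroup.coe_top]
    exact Set.mem_univ g
  rw [Subgroup.mul_normal] at hg
  exact Set.mem_mul.mp hg

/-- **A topological generator of `κ` inside `ker ρ̄_{W,n}`, from `ker ρ̄_{W,n} ⊔ ker κ = ⊤`.** Write a
given topological generator `γ = ν σ` with `ρ̄(ν) = 1`, `κ(σ) = 1`; then `κ(ν) = κ(γ) = 1 ∈ ℤ_p`, so
`γ₀ := ν` is again a topological generator, and it acts trivially on `E[n]`.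
[cite: Washington1997, §13.1–§13.2] -/
theorem exists_isTopGenerator_galoisRepTorsion_eq_one_of_sup_eq_top (W : WeierstrassCurve F) {n : ℤ}
    (hsup : (galoisRepTorsion W n).ker ⊔ κ.kerSubgroup = ⊤) {γ : absoluteGaloisGroup F}
    (hγ : κ.IsTopGenerator γ) :
    ∃ γ₀ : absoluteGaloisGroup F, κ.IsTopGenerator γ₀ ∧ galoisRepTorsion W n γ₀ = 1 := by
  obtain ⟨ν, hν, σ, hσ, rfl⟩ := exists_mem_mul_mem_kerSubgroup_eq_of_sup_eq_top κ hsup γ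
  refine ⟨ν, ?_, MonoidHom.mem_ker.mp hν⟩
  have h : κ (ν * σ) = Multiplicative.ofAdd 1 := hγ
  rw [map_mul, ZpExtension.mem_kerSubgroup.mp hσ, mul_one] at h
  exact h

end AnyField

/-! ### §2. The Galois side at `p = 2` over `ℚ` -/

section RatTwo

variable (W : WeierstrassCurve ℚ) [W.IsElliptic] (κ : ZpExtension ℚ 2)

/-- **`permGal (Gal(ℚ̄/ℚ_∞)) = S₃` from a `3`-cycle and a transposition in `Gal(ℚ̄/ℚ_∞)`** (any
`ℤ₂`-extension `κ`): if `z ∈ ker κ` moves every non-zero point of `E[2]` and `c ∈ ker κ` is odd on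
`{T₀, T₁, T₂}`, every permutation of the letters is `permGal σ` for some `σ ∈ ker κ` — namely one of the
six words `1, z, z², c, cz, cz²`. [cite: SilvermanAEC2009, III.§7 (the representation G_{K̄/K} → Aut(E[m]))] -/
theorem permGal_kerSubgroup_surjective_of_fpf_of_sign_eq_neg_one {z c : absoluteGaloisGroup ℚ}
    (hzκ : z ∈ κ.kerSubgroup) (hz : ∀ P : geomTorsion W 2, z • P = P → P = 0) (hcκ : c ∈ κ.kerSubgroup)
    (hc : Equiv.Perm.sign (permGal W (two_ne_zero : (2 : ℚ) ≠ 0) c) = -1) (g : Equiv.Perm (Fin 3)) :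
    ∃ σ ∈ κ.kerSubgroup, permGal W (two_ne_zero : (2 : ℚ) ≠ 0) σ = g := by
  have h2 : (2 : ℚ) ≠ 0 := two_ne_zero
  -- `z` is fixed-point-free on the letters
  have hzT : ∀ i, permGal W h2 z i ≠ i := by
    intro i hi
    have hT : z • T W h2 i = T W h2 i := by rw [← T_permGal, hi]
    exact coe_T_ne_zero W h2 i (by rw [hz (T W h2 i) hT]; rfl)
  rcases perm_fin_three_eq_word_of_fpf_of_sign_eq_neg_one _ _ hzT hc g with
    rfl | rfl | rfl | rfl | rfl | rfl
  · exact ⟨1, κ.kerSubgroup.one_mem, permGal_one W h2⟩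
  · exact ⟨z, hzκ, rfl⟩
  · exact ⟨z * z, κ.kerSubgroup.mul_mem hzκ hzκ, permGal_mul W h2 z z⟩
  · exact ⟨c, hcκ, rfl⟩
  · exact ⟨c * z, κ.kerSubgroup.mul_mem hcκ hzκ, permGal_mul W h2 c z⟩
  · exact ⟨c * z * z, κ.kerSubgroup.mul_mem (κ.kerSubgroup.mul_mem hcκ hzκ) hzκ,
      by rw [permGal_mul, permGal_mul]⟩

/-- **H6, core form (any `ℤ₂`-extension `κ`): `Γ_ℚ = ker ρ̄_{E,2} · Gal(ℚ̄/ℚ_∞)`** as soon as `E[2]` is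
irreducible and some `c ∈ ker κ` is odd on `{T₀, T₁, T₂}`. `ker κ` contains a `3`-cycle `z`
(`TowerImage.exists_fpf_mem_kerSubgroup_of_irreducible`: `3 ∈ ℤ₂ˣ` and `E[2]` has no fixed vector), so
`permGal (ker κ) = S₃`; for `g ∈ Γ_ℚ` pick `σ ∈ ker κ` with `permGal σ = permGal g`, then `g σ⁻¹` acts
trivially on `E[2] = {O, T₀, T₁, T₂}` and `g = (g σ⁻¹) σ`. [cite: Serre1972, §5.3] -/
theorem ker_galoisRepTorsion_sup_kerSubgroup_eq_top_two_of_sign_eq_neg_one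
    (hirr : W.HasIrreducibleModPGaloisRep 2) {c : absoluteGaloisGroup ℚ} (hcκ : c ∈ κ.kerSubgroup)
    (hc : Equiv.Perm.sign (permGal W (two_ne_zero : (2 : ℚ) ≠ 0) c) = -1) :
    (galoisRepTorsion W 2).ker ⊔ κ.kerSubgroup = ⊤ := by
  obtain ⟨z, hzκ, hz⟩ :=
    AlignedTransportAtTwoFineRoad.TowerImage.exists_fpf_mem_kerSubgroup_of_irreducible W κ (by decide)
      two_ne_zero hirr
  rw [Subgroup.eq_top_iff']
  intro g
  obtain ⟨σ, hσκ, hσ⟩ := permGal_kerSubgroup_surjective_of_fpf_of_sign_eq_neg_one W κ hzκ hz hcκ hc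
    (permGal W two_ne_zero g)
  have hg : g = g * σ⁻¹ * σ := by rw [inv_mul_cancel_right]
  rw [hg]
  refine Subgroup.mul_mem_sup ?_ hσκ
  rw [SteinbergFibreAtTwo.mem_ker_galoisRepTorsion_two_iff]
  intro P
  rw [mul_smul, ← SteinbergFibreAtTwo.smul_eq_smul_of_permGal_eq W hσ (σ⁻¹ • P), smul_inv_smul]

/-- Complex conjugations lie in the kernel of EVERY `ℤ₂`-extension of `ℚ`: `c² = 1`, so `κ(c)` is a
`2`-torsion element of the torsion-free group `ℤ₂`. (The any-`κ` form of the tree's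
`ZpExtension.mem_kerSubgroup_of_isComplexConjugation`; re-proved here to keep the import closure small.)
[cite: Washington1997, §13.1 Prop. 13.2] -/
-- adapted from Literature/NumberTheory/IwasawaTheory/ClassicalMuInvariantOnePrimeProofs.lean:95
private theorem mem_kerSubgroup_of_isComplexConjugation_rat {φ : ℚ →+* ℝ} {c : absoluteGaloisGroup ℚ}
    (hc : IsComplexConjugation φ c) : c ∈ κ.kerSubgroup := by
  rw [ZpExtension.mem_kerSubgroup]
  have h2 : (κ c) ^ 2 = 1 := by rw [← map_pow, hc.sq_eq_one, map_one]
  have h2' := congrArg Multiplicative.toAdd h2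
  rw [toAdd_pow, toAdd_one, smul_eq_zero_iff_right two_ne_zero] at h2'
  exact Multiplicative.toAdd.injective (h2'.trans toAdd_one.symm)

/-- **H6 for ANY `ℤ₂`-extension `κ` of `ℚ`: `Γ_ℚ = ker ρ̄_{E,2} · Gal(ℚ̄/ℚ_∞)`** when `E[2]` is irreducible
and `Δ < 0` — complex conjugation lies in `ker κ` and is a transposition on `E[2]`
(`SteinbergFibreAtTwo.sign_permGal_eq_neg_one_of_isComplexConjugation_of_Δ_neg`). (Replaces the odd
`ker_galoisRepTorsion_sup_kerSubgroup_eq_top hG`, whose hypothesis `p ∤ #ρ̄(Γ)` fails at `2`.)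
[cite: Serre1972, §5.3] -/
theorem ker_galoisRepTorsion_sup_kerSubgroup_eq_top_two_of_irreducible_of_Δ_neg
    (hirr : W.HasIrreducibleModPGaloisRep 2) (hΔ : W.Δ < 0) :
    (galoisRepTorsion W 2).ker ⊔ κ.kerSubgroup = ⊤ := by
  obtain ⟨c, hc⟩ := exists_isComplexConjugation (Rat.castHom ℝ)
  exact ker_galoisRepTorsion_sup_kerSubgroup_eq_top_two_of_sign_eq_neg_one W κ hirr
    (mem_kerSubgroup_of_isComplexConjugation_rat κ hc)
    (SteinbergFibreAtTwo.sign_permGal_eq_neg_one_of_isComplexConjugation_of_Δ_neg W hc hΔ)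

/-- **H6 = device (D) (verbatim binder list of the plan; `κ` cyclotomic): `Γ_ℚ = ker ρ̄_{E,2} · Gal(ℚ̄/ℚ_∞)`.**
Complex conjugation lies in `ker κ` for the cyclotomic `κ` (`TowerImage.mem_kerSubgroup_of_isComplexConjugation`)
and is a transposition when `Δ < 0`. [cite: Serre1972, §5.3] [cite: Washington1997, §13.1] -/
theorem ker_galoisRepTorsion_sup_kerSubgroup_eq_top_two (hκ : κ.IsCyclotomic)
    (hirr : W.HasIrreducibleModPGaloisRep 2) (hΔ : W.Δ < 0) :
    (galoisRepTorsion W 2).ker ⊔ κ.kerSubgroup = ⊤ := by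
  obtain ⟨c, hc⟩ := exists_isComplexConjugation (Rat.castHom ℝ)
  exact ker_galoisRepTorsion_sup_kerSubgroup_eq_top_two_of_sign_eq_neg_one W κ hirr
    (AlignedTransportAtTwoFineRoad.TowerImage.mem_kerSubgroup_of_isComplexConjugation κ hκ hc)
    (SteinbergFibreAtTwo.sign_permGal_eq_neg_one_of_isComplexConjugation_of_Δ_neg W hc hΔ)

/-- **H6′ for ANY `ℤ₂`-extension `κ`: a topological generator `γ₀` of `κ` with `ρ̄_{E,2}(γ₀) = 1`**
(`E[2]` irreducible, `Δ < 0`): split the given generator along H6. [cite: Washington1997, §13.1–§13.2] -/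
theorem exists_isTopGenerator_galoisRepTorsion_two_eq_one_of_irreducible_of_Δ_neg
    (hirr : W.HasIrreducibleModPGaloisRep 2) (hΔ : W.Δ < 0) {γ : absoluteGaloisGroup ℚ}
    (hγ : κ.IsTopGenerator γ) :
    ∃ γ₀ : absoluteGaloisGroup ℚ, κ.IsTopGenerator γ₀ ∧ galoisRepTorsion W 2 γ₀ = 1 :=
  exists_isTopGenerator_galoisRepTorsion_eq_one_of_sup_eq_top κ W
    (ker_galoisRepTorsion_sup_kerSubgroup_eq_top_two_of_irreducible_of_Δ_neg W κ hirr hΔ) hγ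

/-- **H6′ (verbatim binder list; `κ` cyclotomic): a topological generator of `κ` fixing `E[2]` pointwise**
— the `γ₀` of `LevelE.modPTwist_stable_addSubgroup_eq_tPow`. [cite: Washington1997, §13.1–§13.2] -/
theorem exists_isTopGenerator_forall_smul_eq_two (hκ : κ.IsCyclotomic)
    (hirr : W.HasIrreducibleModPGaloisRep 2) (hΔ : W.Δ < 0) {γ : absoluteGaloisGroup ℚ}
    (hγ : κ.IsTopGenerator γ) :
    ∃ γ₀ : absoluteGaloisGroup ℚ, κ.IsTopGenerator γ₀ ∧ galoisRepTorsion W 2 γ₀ = 1 :=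
  exists_isTopGenerator_galoisRepTorsion_eq_one_of_sup_eq_top κ W
    (ker_galoisRepTorsion_sup_kerSubgroup_eq_top_two W κ hκ hirr hΔ) hγ

/-- **H6″: squares fix `μ₄`.** `Gal(ℚ̄/ℚ(μ₄))` is the kernel of the mod-`4` cyclotomic character
`Γ_ℚ → (ℤ/4)ˣ` (`rootsOfUnityFixer_eq_ker`), and `(ℤ/4)ˣ` has exponent `2`. [folklore] -/
theorem sq_mem_rootsOfUnityFixer_four (g : absoluteGaloisGroup ℚ) : g ^ 2 ∈ rootsOfUnityFixer ℚ 4 := by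
  rw [rootsOfUnityFixer_eq_ker ℚ 4, MonoidHom.mem_ker, map_pow]
  exact units_zmod_four_sq_eq_one _

omit [W.IsElliptic] in
/-- **H7, core form (any `ℤ₂`-extension `κ`): the depth element at `2` with the `μ₄`-condition.** For a
topological generator `γ₀` with `ρ̄_{E,2}(γ₀) = 1` and `n ≥ 1`, `σ := γ₀^{2ⁿ} = (γ₀^{2^{n-1}})²` lies in
`ker ρ̄_{E,2} ⊓ Gal(ℚ̄/ℚ_n)` (`κ(σ) = 2ⁿ`), fixes `μ₄` (a square, H6″), and is not in `Gal(ℚ̄/ℚ_{n+1})`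
(`2^{n+1} ∤ 2ⁿ` in `ℤ₂`). [cite: Washington1997, §13.1–§13.2] -/
theorem exists_mem_ker_inf_layerSubgroup_not_mem_two_of_isTopGenerator {γ₀ : absoluteGaloisGroup ℚ}
    (hγ₀ : κ.IsTopGenerator γ₀) (h1 : galoisRepTorsion W 2 γ₀ = 1) {n : ℕ} (hn : 1 ≤ n) :
    ∃ σ ∈ (galoisRepTorsion W 2).ker ⊓ κ.layerSubgroup n,
      σ ∈ rootsOfUnityFixer ℚ 4 ∧ σ ∉ κ.layerSubgroup (n + 1) := by
  obtain ⟨k, rfl⟩ : ∃ k, n = k + 1 := ⟨n - 1, by omega⟩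
  have hκσ : (κ (γ₀ ^ 2 ^ (k + 1))).toAdd = ((2 : ℕ) : ℤ_[2]) ^ (k + 1) := by
    have h : κ γ₀ = Multiplicative.ofAdd 1 := hγ₀
    rw [map_pow, h, ← ofAdd_nsmul, toAdd_ofAdd, nsmul_eq_mul, mul_one, Nat.cast_pow]
  have hp : Prime ((2 : ℕ) : ℤ_[2]) := PadicInt.prime_p
  refine ⟨γ₀ ^ 2 ^ (k + 1), Subgroup.mem_inf.mpr ⟨Subgroup.pow_mem _ (MonoidHom.mem_ker.mpr h1) _, ?_⟩,
    ?_, ?_⟩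
  · rw [ZpExtension.mem_layerSubgroup, hκσ]
  · rw [pow_succ, pow_mul]
    exact sq_mem_rootsOfUnityFixer_four _
  · rw [ZpExtension.mem_layerSubgroup, hκσ, pow_dvd_pow_iff hp.ne_zero hp.not_unit]
    omega

/-- **H7 for ANY `ℤ₂`-extension `κ`** (`E[2]` irreducible, `Δ < 0`, `n ≥ 1`): `∃ σ ∈ ker ρ̄_{E,2} ⊓ Gal(ℚ̄/ℚ_n)`
fixing `μ₄` with `σ ∉ Gal(ℚ̄/ℚ_{n+1})`. [cite: Washington1997, §13.1–§13.2] -/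
theorem exists_mem_ker_inf_layerSubgroup_not_mem_two_of_irreducible_of_Δ_neg
    (hirr : W.HasIrreducibleModPGaloisRep 2) (hΔ : W.Δ < 0) {γ : absoluteGaloisGroup ℚ}
    (hγ : κ.IsTopGenerator γ) {n : ℕ} (hn : 1 ≤ n) :
    ∃ σ ∈ (galoisRepTorsion W 2).ker ⊓ κ.layerSubgroup n,
      σ ∈ rootsOfUnityFixer ℚ 4 ∧ σ ∉ κ.layerSubgroup (n + 1) := by
  obtain ⟨γ₀, hγ₀, h1⟩ :=
    exists_isTopGenerator_galoisRepTorsion_two_eq_one_of_irreducible_of_Δ_neg W κ hirr hΔ hγ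
  exact exists_mem_ker_inf_layerSubgroup_not_mem_two_of_isTopGenerator W κ hγ₀ h1 hn

/-- **H7 (verbatim binder list; `κ` cyclotomic): the depth element at `2` with the `μ₄`-condition** —
replaces the odd `exists_mem_ker_inf_layerSubgroup_not_mem_layerSubgroup_succ hirr hns`.
[cite: Washington1997, §13.1–§13.2] -/
theorem exists_mem_ker_inf_layerSubgroup_not_mem_two (hκ : κ.IsCyclotomic)
    (hirr : W.HasIrreducibleModPGaloisRep 2) (hΔ : W.Δ < 0) {γ : absoluteGaloisGroup ℚ}
    (hγ : κ.IsTopGenerator γ) {n : ℕ} (hn : 1 ≤ n) :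
    ∃ σ ∈ (galoisRepTorsion W 2).ker ⊓ κ.layerSubgroup n,
      σ ∈ rootsOfUnityFixer ℚ 4 ∧ σ ∉ κ.layerSubgroup (n + 1) := by
  obtain ⟨γ₀, hγ₀, h1⟩ := exists_isTopGenerator_forall_smul_eq_two W κ hκ hirr hΔ hγ
  exact exists_mem_ker_inf_layerSubgroup_not_mem_two_of_isTopGenerator W κ hγ₀ h1 hn

/-- **H9 (the genuine use of `HasSurjectiveModNGaloisRep 2`): no non-zero point of `E[2]` is fixed by a
subgroup `U ⊇ [Γ_ℚ, Γ_ℚ]`, i.e. `E(ℚ^{ab})[2] = 0`.** `ρ̄₂` onto makes `permGal` onto `S₃`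
(`SteinbergFibreAtTwo.permGal_surjective_of_hasSurjectiveModNGaloisRep_two`); lifting the transpositions
`(0 1)`, `(1 2)` to `σ, τ ∈ Γ_ℚ`, the commutator `[σ, τ] ∈ [Γ, Γ] ≤ U` acts on `{T₀, T₁, T₂}` as the `3`-cycle
`[(0 1), (1 2)]`, which moves every letter; a fixed `m` is `O` or some `T_i`. (Replaces the odd
`GaloisImage.geomTorsion_eq_zero_of_fixed_of_commutator_le hp2 hirr`; FALSE at `2` for image `A₃`.)
[cite: Serre1972, §5.3] -/
theorem geomTorsion_eq_zero_of_fixed_of_commutator_le_two (h2 : W.HasSurjectiveModNGaloisRep 2) {U : Subgroup (absoluteGaloisGroup ℚ)}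
    (hU : commutator (absoluteGaloisGroup ℚ) ≤ U) (m : geomTorsion W ((2 : ℕ) : ℤ))
    (hm : ∀ σ ∈ U, σ • m = m) : m = 0 := by
  have h2' : (2 : ℚ) ≠ 0 := two_ne_zero
  have hs := SteinbergFibreAtTwo.permGal_surjective_of_hasSurjectiveModNGaloisRep_two W h2
  obtain ⟨σ, hσ⟩ := hs (Equiv.swap 0 1)
  obtain ⟨τ, hτ⟩ := hs (Equiv.swap 1 2)
  -- `permGal` as a homomorphism, to evaluate it on the commutator `⁅σ, τ⁆ ∈ [Γ, Γ] ≤ U`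
  let f : absoluteGaloisGroup ℚ →* Equiv.Perm (Fin 3) :=
    MonoidHom.mk' (permGal W h2') (permGal_mul W h2')
  have hu : ⁅σ, τ⁆ ∈ U :=
    hU (Subgroup.commutator_mem_commutator (Subgroup.mem_top σ) (Subgroup.mem_top τ))
  have hfu : permGal W h2' ⁅σ, τ⁆ = ⁅Equiv.swap (0 : Fin 3) 1, Equiv.swap (1 : Fin 3) 2⁆ := by
    change f ⁅σ, τ⁆ = _
    rw [map_commutatorElement]
    change ⁅permGal W h2' σ, permGal W h2' τ⁆ = _
    rw [hσ, hτ]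
  rcases eq_zero_or_eq_T W h2' m with hm0 | ⟨i, rfl⟩
  · exact hm0
  · exfalso
    have hfix : ⁅σ, τ⁆ • T W h2' i = T W h2' i := hm _ hu
    rw [← T_permGal, hfu] at hfix
    exact commutator_swap_apply_ne i (T_injective W h2' hfix)

end RatTwo

end Summit.BirchSwinnertonDyer.BirchSwinnertonDyer.Rank1Residual

end
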